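import Mathlib.Analysis.SpecialFunctions.Gaussian.GaussianIntegral
import Mathlib.MeasureTheory.Integral.Pi
import Mathlib.Analysis.Calculus.ParametricIntegral
import Literature.Barriers.CriticalPhenomena.RigorousRGSmallParameterWellPosed
import HarnessLib

/-!
# `RigorousRGSmallParameter`: moments of the finite-volume long-range `|φ|⁴` measure and
# differentiability of the finite-volume susceptibility in `ν`

Companion file of `Literature/Barriers/CriticalPhenomena/RigorousRGSmallParameter.lean` (Slade,
CMP 358 (2018), arXiv:1611.06169), continuing `RigorousRGSmallParameterWellPosed.lean`. That file
proves the stability bound `V ≥ (g/16)Σ_{x,i}(φ_xⁱ)⁴ + Σ_x|φ_x|² - D`, integrability of `Fe^{-V}`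
for observables with `|F| ≤ 1 + Σ_x|φ_x|²`, that `⟨·⟩_{g,ν,N}` (`gibbsMeasure`, an exponential
tilt) is a probability measure, and `⟨F⟩ = ∫Fe^{-V}/∫e^{-V}` (`expect_eq_integral_div`).

## Why this file exists

Proposition 8.2.2 of the paper — the renormalisation-group output vendored as a named fact in
the proof architecture of the barrier — is a statement about the `N → ∞` limits of the
finite-volume susceptibility `χ_N(g,ν)` AND of "`χ̂_N'` … the derivative of `χ̂_N` with respect
to `ν₀` with `m², g` held fixed … equal to the partial derivative of `χ_N` with respect to `ν`"
(§8.2, after Lemma 8.2.1), whose existence the printed notation presupposes. Differentiating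
`⟨φ₀·φ_x⟩_{g,ν,N}` in `ν` brings down `∂_νV = ½Σ_x|φ_x|²`, i.e. observables of QUARTIC growth,
beyond the `1 + Σ_x|φ_x|²` class of the well-posedness file. This file proves, for the
formalised model and every `g > 0` (using of the fractional-Laplacian matrix only that it is a
real matrix on the finite torus):

* `potential_ge_sqNorm_sq` — the per-site form `V(φ) ≥ (g/8)Σ_x|φ_x|⁴ - K` of the stability
  bound; `potential_eq_potential_zero_add`, `potential_mono_nu` — `V_{g,ν} = V_{g,0} + ½νS`,
  `S(φ) = Σ_x|φ_x|²`, monotone in `ν`;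
* `weight_mul_exp_neg_potential_le`, `integrable_weight_mul_exp_neg_potential` — ALL polynomial
  moments: `Π_x(1+|φ_x|²)^k e^{-V(φ)}` is dominated by a constant times the standard Gaussian
  density `Π_{x,i}e^{-(φ_xⁱ)²}` (`(1+s)^k e^{-cs²} ≤ e^{(k+1)²/(4c)}e^{-s}`,
  `one_add_pow_mul_exp_neg_sq_le`), hence Lebesgue integrable on `(ℝⁿ)^Λ`
  (`integrable_gaussianProduct`); `integral_exp_neg_potential_pos` — `Z_{g,ν,N} > 0`;
* `hasDerivAt_integral_mul_exp_neg_potential`, `hasDerivAt_partitionFunction`,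
  `hasDerivAt_expect` — differentiation under the integral sign in `ν` for continuous
  observables of polynomial growth, with the fluctuation formula
  `∂_ν⟨G⟩_{g,ν,N} = -½(⟨G·S⟩ - ⟨G⟩⟨S⟩)`;
* `differentiableAt_torusSusceptibility`, `differentiable_torusSusceptibilityPow` —
  `ν ↦ χ_N(g,ν) = n⁻¹Σ_x⟨φ₀·φ_x⟩_{g,ν,N}` (`torusSusceptibility`, `torusSusceptibilityPow`) is
  differentiable on `ℝ`: the object `χ̂'_N = ∂χ_N/∂ν` of §8.2 exists for the formalised model.

All statements are finite-dimensional real analysis (Mathlib: `Integrable.fintype_prod`,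
`integrable_exp_neg_mul_sq`, `hasDerivAt_integral_of_dominated_loc_of_deriv_le`,
`HasDerivAt.div`); nothing depends on the decay of the fractional Laplacian or on the
renormalisation group. Not treated: `n = 0`, higher derivatives, analyticity in `ν`, the
`N → ∞` limit.
-/

noncomputable section

namespace Literature.Barriers.CriticalPhenomena

open MeasureTheory Filter Set Literature.Probability.LatticeModels
open scoped _root_.Topology BigOperators

namespace LongRangePhi4

variable {d M n : ℕ}

/-- The mass term splits off linearly: `V_{g,ν}(φ) = V_{g,0}(φ) + ½νΣ_x|φ_x|²`
(`|φ_x|² = sqNorm (φ x)`). [cite: Slade2017, §1.2 (definition of V)] -/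
theorem potential_eq_potential_zero_add [NeZero M] (α g ν : ℝ)
    (φ : TorusSite d M → Fin n → ℝ) :
    potential d M n α g ν φ = potential d M n α g 0 φ + ν / 2 * ∑ x, sqNorm (φ x) := by
  simp only [potential, zero_div, zero_mul, add_zero, Finset.mul_sum]
  rw [← Finset.sum_add_distrib]
  refine Finset.sum_congr rfl fun x _ => ?_
  ring

/-- `V_{g,ν}(φ)` is monotone in `ν` (since `Σ_x|φ_x|² ≥ 0`). [cite: Slade2017, §1.2 (definition of V)] -/
theorem potential_mono_nu [NeZero M] (α g : ℝ) {ν₁ ν₂ : ℝ} (h : ν₁ ≤ ν₂)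
    (φ : TorusSite d M → Fin n → ℝ) :
    potential d M n α g ν₁ φ ≤ potential d M n α g ν₂ φ := by
  rw [potential_eq_potential_zero_add α g ν₁, potential_eq_potential_zero_add α g ν₂]
  have hS : 0 ≤ ∑ x, sqNorm (φ x) := Finset.sum_nonneg fun x _ => sqNorm_nonneg _
  nlinarith

/-- **Stability of the potential, per-site form.** For `g > 0` there is a constant
`K = K(d,M,n,α,g,ν)` with `V_{g,ν}(φ) ≥ (g/8)Σ_x|φ_x|⁴ - K` for all fields `φ` (companion of
`potential_lower_bound` in `RigorousRGSmallParameterWellPosed`, which is per-coordinate,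
`(g/16)Σ_{x,i}(φ_xⁱ)⁴ + Σ_x|φ_x|² - D`): by `abs_interaction_le` the quadratic
terms are `≥ -βΣ_x|φ_x|²` with `β = (Σ_{x,y}|M_{xy}| - ν)/2`, and
`(g/4)t² - βt ≥ (g/8)t² - 2β²/g`. (This is why `Z_{g,ν,N} < ∞` for every `ν ∈ ℝ` once
`g > 0`, as presupposed in §1.2.) [cite: Slade2017, §1.2 (definition of V, g > 0)] -/
theorem potential_ge_sqNorm_sq [NeZero M] (α : ℝ) {g : ℝ} (hg : 0 < g) (ν : ℝ) :
    ∃ Kc : ℝ, ∀ φ : TorusSite d M → Fin n → ℝ,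
      g / 8 * ∑ x, sqNorm (φ x) ^ 2 - Kc ≤ potential d M n α g ν φ := by
  set κ : ℝ := ∑ x, ∑ y, |fracLaplacianTorus d (α / 2) M x y| with hκ_def
  set β : ℝ := (κ - ν) / 2 with hβ_def
  refine ⟨(Fintype.card (TorusSite d M) : ℝ) * (2 * β ^ 2 / g), fun φ => ?_⟩
  have hint := abs_interaction_le (fun x y => fracLaplacianTorus d (α / 2) M x y) φ
  rw [← hκ_def] at hint
  have hint' := (abs_le.1 hint).1
  -- pointwise quartic bound
  have hpt : ∀ x, g / 8 * sqNorm (φ x) ^ 2 - 2 * β ^ 2 / g ≤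
      g / 4 * sqNorm (φ x) ^ 2 - β * sqNorm (φ x) := by
    intro x
    have : g / 4 * sqNorm (φ x) ^ 2 - β * sqNorm (φ x) - (g / 8 * sqNorm (φ x) ^ 2 - 2 * β ^ 2 / g)
        = g / 8 * (sqNorm (φ x) - 4 * β / g) ^ 2 := by
      field_simp
      ring
    nlinarith [sq_nonneg (sqNorm (φ x) - 4 * β / g)]
  have hsum := Finset.sum_le_sum fun x (_ : x ∈ Finset.univ) => hpt x
  rw [Finset.sum_sub_distrib, Finset.sum_const, Finset.card_univ, nsmul_eq_mul,
    ← Finset.mul_sum] at hsum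
  -- unfold the potential
  have hV : potential d M n α g ν φ = ∑ x, (g / 4 * sqNorm (φ x) ^ 2 + ν / 2 * sqNorm (φ x)) +
      (1 / 2) * ∑ x, ∑ i, φ x i * ∑ y, fracLaplacianTorus d (α / 2) M x y * φ y i := by
    simp only [potential, Finset.sum_add_distrib, Finset.mul_sum]
  rw [hV]
  have h2 : ∑ x, (g / 4 * sqNorm (φ x) ^ 2 - β * sqNorm (φ x)) =
      ∑ x, (g / 4 * sqNorm (φ x) ^ 2 + ν / 2 * sqNorm (φ x)) - κ / 2 * ∑ x, sqNorm (φ x) := by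
    rw [Finset.mul_sum, ← Finset.sum_sub_distrib]
    refine Finset.sum_congr rfl fun x _ => ?_
    rw [hβ_def]
    ring
  rw [h2] at hsum
  nlinarith

/-- Elementary domination of a polynomially weighted quartic exponential by a Gaussian:
`(1+s)^k e^{-cs²} ≤ e^{(k+1)²/(4c)} e^{-s}` for `s ≥ 0`, `c > 0` (`1+s ≤ eˢ` and
`(k+1)s ≤ cs² + (k+1)²/(4c)`). [folklore] -/
theorem one_add_pow_mul_exp_neg_sq_le {s c : ℝ} (hs : 0 ≤ s) (hc : 0 < c) (k : ℕ) :
    (1 + s) ^ k * Real.exp (-(c * s ^ 2)) ≤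
      Real.exp (((k : ℝ) + 1) ^ 2 / (4 * c)) * Real.exp (-s) := by
  have h1 : (1 + s) ^ k ≤ Real.exp ((k : ℝ) * s) := by
    calc (1 + s) ^ k ≤ Real.exp s ^ k := by
          gcongr
          linarith [Real.add_one_le_exp s]
      _ = Real.exp ((k : ℝ) * s) := by rw [← Real.exp_nat_mul]
  have hkey : ((k : ℝ) + 1) * s ≤ c * s ^ 2 + ((k : ℝ) + 1) ^ 2 / (4 * c) := by
    have : c * s ^ 2 + ((k : ℝ) + 1) ^ 2 / (4 * c) - ((k : ℝ) + 1) * s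
        = (2 * c * s - ((k : ℝ) + 1)) ^ 2 / (4 * c) := by
      field_simp
      ring
    have hnn : 0 ≤ (2 * c * s - ((k : ℝ) + 1)) ^ 2 / (4 * c) := by positivity
    linarith
  calc (1 + s) ^ k * Real.exp (-(c * s ^ 2))
      ≤ Real.exp ((k : ℝ) * s) * Real.exp (-(c * s ^ 2)) :=
        mul_le_mul_of_nonneg_right h1 (Real.exp_pos _).le
    _ = Real.exp ((k : ℝ) * s - c * s ^ 2) := by rw [← Real.exp_add]; ring_nf
    _ ≤ Real.exp (((k : ℝ) + 1) ^ 2 / (4 * c) + -s) := Real.exp_le_exp.2 (by linarith)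
    _ = Real.exp (((k : ℝ) + 1) ^ 2 / (4 * c)) * Real.exp (-s) := Real.exp_add _ _

/-- `Σ_i t_i ≤ Π_i (1 + t_i)` for `t_i ≥ 0`. [folklore] -/
theorem sum_le_prod_one_add {ι : Type*} (s : Finset ι) (t : ι → ℝ) (ht : ∀ i ∈ s, 0 ≤ t i) :
    ∑ i ∈ s, t i ≤ ∏ i ∈ s, (1 + t i) := by
  classical
  induction s using Finset.induction_on with
  | empty => simp
  | insert a s ha ih =>
    rw [Finset.sum_insert ha, Finset.prod_insert ha]
    have hta : 0 ≤ t a := ht a (Finset.mem_insert_self a s)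
    have hs : ∀ i ∈ s, 0 ≤ t i := fun i hi => ht i (Finset.mem_insert_of_mem hi)
    have ih' := ih hs
    have hsum : 0 ≤ ∑ i ∈ s, t i := Finset.sum_nonneg hs
    have hprod1 : 1 ≤ ∏ i ∈ s, (1 + t i) := by
      have h := Finset.prod_le_prod (s := s) (f := fun _ => (1 : ℝ)) (g := fun i => 1 + t i)
        (fun _ _ => zero_le_one) (fun i hi => by linarith [hs i hi])
      rwa [Finset.prod_const_one] at h
    nlinarith


/-- `|φ_x·φ_y| ≤ Σ_z|φ_z|²` (so the susceptibility summands have quadratic growth). [folklore] -/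
theorem abs_dot_le_sum_sqNorm [NeZero M] (φ : TorusSite d M → Fin n → ℝ) (x y : TorusSite d M) :
    |∑ i, φ x i * φ y i| ≤ ∑ z, sqNorm (φ z) := by
  have hSx : ∀ x, sqNorm (φ x) ≤ ∑ z, sqNorm (φ z) := fun x =>
    Finset.single_le_sum (f := fun x => sqNorm (φ x)) (fun _ _ => sqNorm_nonneg _)
      (Finset.mem_univ x)
  calc |∑ i, φ x i * φ y i| ≤ ∑ i, |φ x i * φ y i| := Finset.abs_sum_le_sum_abs _ _
    _ ≤ ∑ i, ((φ x i) ^ 2 + (φ y i) ^ 2) / 2 :=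
        Finset.sum_le_sum fun i _ => by
          rw [abs_mul]
          nlinarith [sq_nonneg (|φ x i| - |φ y i|), sq_abs (φ x i), sq_abs (φ y i)]
    _ = (sqNorm (φ x) + sqNorm (φ y)) / 2 := by
        simp only [sqNorm, Finset.sum_div, Finset.sum_add_distrib, add_div]
    _ ≤ ∑ z, sqNorm (φ z) := by linarith [hSx x, hSx y]

/-- `φ ↦ |φ_x|²` is continuous on field space. [folklore] -/
theorem continuous_sqNorm_apply (x : TorusSite d M) :
    Continuous fun φ : TorusSite d M → Fin n → ℝ => sqNorm (φ x) := by
  unfold sqNorm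
  fun_prop

/-- **Gaussian domination of the weighted Boltzmann factor.** For `g > 0`, `ν ∈ ℝ`, `k ∈ ℕ`
there is `A > 0` with `Π_x(1+|φ_x|²)^k · e^{-V_{g,ν}(φ)} ≤ A·Π_xΠ_i e^{-(φ_xⁱ)²}` for all `φ`
(`potential_ge_sqNorm_sq`, then `one_add_pow_mul_exp_neg_sq_le` site by site with `c = g/8`,
and `|φ_x|⁴ = (Σ_i(φ_xⁱ)²)²`, `e^{-Σ_i(φ_xⁱ)²} = Π_i e^{-(φ_xⁱ)²}`). [folklore] -/
theorem weight_mul_exp_neg_potential_le [NeZero M] (α : ℝ) {g : ℝ} (hg : 0 < g) (ν : ℝ)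
    (k : ℕ) :
    ∃ A : ℝ, 0 < A ∧ ∀ φ : TorusSite d M → Fin n → ℝ,
      (∏ x, (1 + sqNorm (φ x)) ^ k) * Real.exp (-potential d M n α g ν φ) ≤
        A * ∏ x, ∏ i, Real.exp (-(φ x i) ^ 2) := by
  obtain ⟨Kc, hKc⟩ := potential_ge_sqNorm_sq (d := d) (M := M) (n := n) α hg ν
  set B : ℝ := Real.exp (((k : ℝ) + 1) ^ 2 / (4 * (g / 8))) with hB_def
  refine ⟨Real.exp Kc * B ^ Fintype.card (TorusSite d M), by positivity, fun φ => ?_⟩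
  have hexp : Real.exp (-potential d M n α g ν φ) ≤
      Real.exp Kc * ∏ x, Real.exp (-(g / 8 * sqNorm (φ x) ^ 2)) := by
    rw [← Real.exp_sum, ← Real.exp_add]
    refine Real.exp_le_exp.2 ?_
    have h1 := hKc φ
    have h2 : ∑ x, -(g / 8 * sqNorm (φ x) ^ 2) = -(g / 8 * ∑ x, sqNorm (φ x) ^ 2) := by
      rw [Finset.sum_neg_distrib, Finset.mul_sum]
    linarith
  have hsite : ∀ x, (1 + sqNorm (φ x)) ^ k * Real.exp (-(g / 8 * sqNorm (φ x) ^ 2)) ≤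
      B * Real.exp (-sqNorm (φ x)) := fun x =>
    one_add_pow_mul_exp_neg_sq_le (sqNorm_nonneg _) (by positivity) k
  have hgauss : ∀ x, Real.exp (-sqNorm (φ x)) = ∏ i, Real.exp (-(φ x i) ^ 2) := by
    intro x
    rw [sqNorm, ← Finset.sum_neg_distrib, Real.exp_sum]
  have hw0 : ∀ x, 0 ≤ (1 + sqNorm (φ x)) ^ k := fun x =>
    pow_nonneg (add_nonneg zero_le_one (sqNorm_nonneg _)) _
  calc (∏ x, (1 + sqNorm (φ x)) ^ k) * Real.exp (-potential d M n α g ν φ)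
      ≤ (∏ x, (1 + sqNorm (φ x)) ^ k) *
          (Real.exp Kc * ∏ x, Real.exp (-(g / 8 * sqNorm (φ x) ^ 2))) :=
        mul_le_mul_of_nonneg_left hexp (Finset.prod_nonneg fun x _ => hw0 x)
    _ = Real.exp Kc *
          ∏ x, ((1 + sqNorm (φ x)) ^ k * Real.exp (-(g / 8 * sqNorm (φ x) ^ 2))) := by
        rw [Finset.prod_mul_distrib]
        ring
    _ ≤ Real.exp Kc * ∏ x, (B * Real.exp (-sqNorm (φ x))) :=
        mul_le_mul_of_nonneg_left
          (Finset.prod_le_prod (fun x _ => mul_nonneg (hw0 x) (Real.exp_pos _).le)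
            fun x _ => hsite x)
          (Real.exp_pos _).le
    _ = Real.exp Kc * B ^ Fintype.card (TorusSite d M) * ∏ x, ∏ i, Real.exp (-(φ x i) ^ 2) := by
        rw [Finset.prod_mul_distrib, Finset.prod_const, Finset.card_univ]
        simp_rw [hgauss]
        ring

/-- The standard Gaussian density `Π_{x∈Λ}Π_{i≤n} e^{-(φ_xⁱ)²}` is Lebesgue integrable on
`(ℝⁿ)^Λ` (iterated `Integrable.fintype_prod` from `∫_ℝ e^{-t²}dt < ∞`). [folklore] -/
theorem integrable_gaussianProduct [NeZero M] :
    Integrable (fun φ : TorusSite d M → Fin n → ℝ => ∏ x, ∏ i, Real.exp (-(φ x i) ^ 2)) := by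
  have h1 : Integrable (fun t : ℝ => Real.exp (-t ^ 2)) := by
    simpa using integrable_exp_neg_mul_sq (b := 1) one_pos
  have h2 : Integrable (fun v : Fin n → ℝ => ∏ i, Real.exp (-(v i) ^ 2)) := by
    have := Integrable.fintype_prod (ι := Fin n) (f := fun _ (t : ℝ) => Real.exp (-t ^ 2))
      (μ := fun _ => volume) (fun _ => h1)
    simpa [volume_pi] using this
  have := Integrable.fintype_prod (ι := TorusSite d M)
    (f := fun _ (v : Fin n → ℝ) => ∏ i, Real.exp (-(v i) ^ 2)) (μ := fun _ => volume)
    (fun _ => h2)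
  simpa [volume_pi] using this

/-- For `g > 0` the weighted Boltzmann factor `Π_x(1+|φ_x|²)^k e^{-V_{g,ν}(φ)}` is Lebesgue
integrable on `(ℝⁿ)^Λ`: all polynomial moments of the finite-volume Gibbs weight are finite.
[cite: Slade2017, §1.2 (partition function and expectation)] -/
theorem integrable_weight_mul_exp_neg_potential [NeZero M] (α : ℝ) {g : ℝ} (hg : 0 < g)
    (ν : ℝ) (k : ℕ) :
    Integrable (fun φ : TorusSite d M → Fin n → ℝ =>
      (∏ x, (1 + sqNorm (φ x)) ^ k) * Real.exp (-potential d M n α g ν φ)) := by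
  obtain ⟨A, hA, hle⟩ := weight_mul_exp_neg_potential_le (d := d) (M := M) (n := n) α hg ν k
  refine ((integrable_gaussianProduct (d := d) (M := M) (n := n)).const_mul A).mono' ?_
    (ae_of_all _ fun φ => ?_)
  · refine Continuous.aestronglyMeasurable ?_
    have hc := continuous_potential (d := d) (M := M) (n := n) α g ν
    have hs := fun x => continuous_sqNorm_apply (d := d) (M := M) (n := n) x
    fun_prop
  · rw [Real.norm_eq_abs, abs_of_nonneg (mul_nonneg (Finset.prod_nonneg fun x _ =>
      pow_nonneg (add_nonneg zero_le_one (sqNorm_nonneg _)) _) (Real.exp_pos _).le)]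
    exact hle φ

/-- **The partition function is positive**: `0 < Z_{g,ν,N} = ∫e^{-V_{g,ν}(φ)}dφ` for `g > 0`.
[cite: Slade2017, §1.2 (partition function)] -/
theorem integral_exp_neg_potential_pos [NeZero M] (α : ℝ) {g : ℝ} (hg : 0 < g) (ν : ℝ) :
    0 < ∫ φ : TorusSite d M → Fin n → ℝ, Real.exp (-potential d M n α g ν φ) :=
  integral_exp_pos (integrable_exp_neg_potential (α := α) (ν := ν) hg)

/-- **Differentiation under the integral sign in `ν`.** For `g > 0` and a continuous observable
`G` of polynomial growth (`|G(φ)| ≤ B·Π_x(1+|φ_x|²)^k`), `ν ↦ ∫G(φ)e^{-V_{g,ν}(φ)}dφ` has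
derivative `∫G(φ)(-½Σ_x|φ_x|²)e^{-V_{g,ν₀}(φ)}dφ` at `ν₀` (`∂_νV = ½Σ_x|φ_x|²`; domination on
`|ν - ν₀| < 1` by `½|B|Π_x(1+|φ_x|²)^{k+1}e^{-V_{g,ν₀-1}}`, integrable by
`integrable_weight_mul_exp_neg_potential`; Mathlib's
`hasDerivAt_integral_of_dominated_loc_of_deriv_le`). [folklore] -/
theorem hasDerivAt_integral_mul_exp_neg_potential [NeZero M] (α : ℝ) {g : ℝ} (hg : 0 < g)
    (ν₀ : ℝ) {G : (TorusSite d M → Fin n → ℝ) → ℝ} (hGc : Continuous G) {B : ℝ} {k : ℕ}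
    (hGb : ∀ φ, |G φ| ≤ B * ∏ x, (1 + sqNorm (φ x)) ^ k) :
    HasDerivAt (fun ν => ∫ φ, G φ * Real.exp (-potential d M n α g ν φ))
      (∫ φ, G φ * (-(∑ x, sqNorm (φ x)) / 2) * Real.exp (-potential d M n α g ν₀ φ)) ν₀ := by
  have hVc := fun ν => continuous_potential (d := d) (M := M) (n := n) α g ν
  have hSc : Continuous fun φ : TorusSite d M → Fin n → ℝ => ∑ x, sqNorm (φ x) := by
    have hs := fun x => continuous_sqNorm_apply (d := d) (M := M) (n := n) x
    fun_prop
  have hw0 : ∀ (φ : TorusSite d M → Fin n → ℝ) (j : ℕ), 0 ≤ ∏ x, (1 + sqNorm (φ x)) ^ j :=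
    fun φ j => Finset.prod_nonneg fun x _ => pow_nonneg (add_nonneg zero_le_one (sqNorm_nonneg _)) _
  have hS0 : ∀ φ : TorusSite d M → Fin n → ℝ, 0 ≤ ∑ x, sqNorm (φ x) := fun φ =>
    Finset.sum_nonneg fun x _ => sqNorm_nonneg _
  have hSle : ∀ φ : TorusSite d M → Fin n → ℝ, ∑ x, sqNorm (φ x) ≤ ∏ x, (1 + sqNorm (φ x)) :=
    fun φ => sum_le_prod_one_add _ _ fun x _ => sqNorm_nonneg _
  -- integrability of `|B| ∏(1+t)^k e^{-V_{ν₀}}` and of the bound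
  have hint_k := integrable_weight_mul_exp_neg_potential (d := d) (M := M) (n := n) α hg ν₀ k
  have hint_b := integrable_weight_mul_exp_neg_potential (d := d) (M := M) (n := n) α hg
    (ν₀ - 1) (k + 1)
  have key := hasDerivAt_integral_of_dominated_loc_of_deriv_le (μ := volume)
    (F := fun ν φ => G φ * Real.exp (-potential d M n α g ν φ))
    (F' := fun ν φ => G φ * (-(∑ x, sqNorm (φ x)) / 2) * Real.exp (-potential d M n α g ν φ))
    (x₀ := ν₀) (s := Metric.ball ν₀ 1)
    (bound := fun φ => |B| / 2 * ((∏ x, (1 + sqNorm (φ x)) ^ (k + 1)) *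
      Real.exp (-potential d M n α g (ν₀ - 1) φ)))
    (Metric.ball_mem_nhds ν₀ one_pos) ?_ ?_ ?_ ?_ ?_ ?_
  · exact key.2
  · exact Eventually.of_forall fun ν => (hGc.mul (hVc ν).neg.rexp).aestronglyMeasurable
  · refine (hint_k.const_mul |B|).mono' (hGc.mul (hVc ν₀).neg.rexp).aestronglyMeasurable
      (ae_of_all _ fun φ => ?_)
    rw [Real.norm_eq_abs, abs_mul, abs_of_nonneg (Real.exp_pos _).le]
    calc |G φ| * Real.exp (-potential d M n α g ν₀ φ)
        ≤ (|B| * ∏ x, (1 + sqNorm (φ x)) ^ k) * Real.exp (-potential d M n α g ν₀ φ) := by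
          refine mul_le_mul_of_nonneg_right ?_ (Real.exp_pos _).le
          exact (hGb φ).trans (mul_le_mul_of_nonneg_right (le_abs_self B) (hw0 φ k))
      _ = |B| * ((∏ x, (1 + sqNorm (φ x)) ^ k) * Real.exp (-potential d M n α g ν₀ φ)) := by
          ring
  · exact ((hGc.mul (by fun_prop)).mul (hVc ν₀).neg.rexp).aestronglyMeasurable
  · refine ae_of_all _ fun φ ν hν => ?_
    have hν' : ν₀ - 1 ≤ ν := by
      have := Metric.mem_ball.1 hν
      rw [Real.dist_eq] at this
      linarith [abs_lt.1 this]
    have hexp : Real.exp (-potential d M n α g ν φ) ≤ Real.exp (-potential d M n α g (ν₀ - 1) φ) :=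
      Real.exp_le_exp.2 (neg_le_neg (potential_mono_nu α g hν' φ))
    rw [Real.norm_eq_abs, abs_mul, abs_mul, abs_of_nonneg (Real.exp_pos _).le, abs_div,
      abs_neg, abs_of_nonneg (hS0 φ), abs_two]
    have hP0 : 0 ≤ ∏ x, (1 + sqNorm (φ x)) :=
      Finset.prod_nonneg fun x _ => add_nonneg zero_le_one (sqNorm_nonneg _)
    calc |G φ| * ((∑ x, sqNorm (φ x)) / 2) * Real.exp (-potential d M n α g ν φ)
        ≤ (|B| * ∏ x, (1 + sqNorm (φ x)) ^ k) * ((∏ x, (1 + sqNorm (φ x))) / 2) *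
            Real.exp (-potential d M n α g (ν₀ - 1) φ) := by
          refine mul_le_mul ?_ hexp (Real.exp_pos _).le ?_
          · refine mul_le_mul ?_ ?_ (div_nonneg (hS0 φ) zero_le_two)
              (mul_nonneg (abs_nonneg B) (hw0 φ k))
            · exact (hGb φ).trans (mul_le_mul_of_nonneg_right (le_abs_self B) (hw0 φ k))
            · linarith [hSle φ]
          · exact mul_nonneg (mul_nonneg (abs_nonneg B) (hw0 φ k)) (div_nonneg hP0 zero_le_two)
      _ = |B| / 2 * ((∏ x, (1 + sqNorm (φ x)) ^ (k + 1)) *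
            Real.exp (-potential d M n α g (ν₀ - 1) φ)) := by
          rw [show (∏ x, (1 + sqNorm (φ x)) ^ (k + 1)) =
              (∏ x, (1 + sqNorm (φ x)) ^ k) * ∏ x, (1 + sqNorm (φ x)) by
            rw [← Finset.prod_mul_distrib]
            refine Finset.prod_congr rfl fun x _ => ?_
            ring]
          ring
  · exact hint_b.const_mul _
  · refine ae_of_all _ fun φ ν _ => ?_
    have hfun : (fun ν => G φ * Real.exp (-potential d M n α g ν φ)) =
        fun ν => G φ * Real.exp (-(potential d M n α g 0 φ + ν / 2 * ∑ x, sqNorm (φ x))) := by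
      funext ν
      rw [potential_eq_potential_zero_add α g ν]
    rw [hfun]
    have h1 : HasDerivAt (fun ν : ℝ => -(potential d M n α g 0 φ + ν / 2 * ∑ x, sqNorm (φ x)))
        (-(1 / 2 * ∑ x, sqNorm (φ x))) ν :=
      ((((hasDerivAt_id' ν).div_const 2).mul_const (∑ x, sqNorm (φ x))).const_add
        (potential d M n α g 0 φ)).fun_neg
    have h2 := (h1.exp).const_mul (G φ)
    refine h2.congr_deriv ?_
    rw [← potential_eq_potential_zero_add α g ν]
    ring

/-- `∂_νZ_{g,ν,N} = ∫(-½Σ_x|φ_x|²)e^{-V_{g,ν}(φ)}dφ` for `g > 0`. [folklore] -/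
theorem hasDerivAt_partitionFunction [NeZero M] (α : ℝ) {g : ℝ} (hg : 0 < g) (ν₀ : ℝ) :
    HasDerivAt (fun ν => ∫ φ : TorusSite d M → Fin n → ℝ, Real.exp (-potential d M n α g ν φ))
      (∫ φ : TorusSite d M → Fin n → ℝ,
        (-(∑ x, sqNorm (φ x)) / 2) * Real.exp (-potential d M n α g ν₀ φ)) ν₀ := by
  have h := hasDerivAt_integral_mul_exp_neg_potential (d := d) (M := M) (n := n) α hg ν₀
    (G := fun _ => (1 : ℝ)) continuous_const (B := 1) (k := 0) (fun φ => by simp)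
  simpa using h

/-- **Fluctuation formula.** For `g > 0` and a continuous observable `G` of polynomial growth,
`ν ↦ ⟨G⟩_{g,ν,N}` is differentiable with
`∂_ν⟨G⟩ = -½(⟨G·S⟩ - ⟨G⟩⟨S⟩)`, `S(φ) = Σ_x|φ_x|²` (quotient rule on `∫Ge^{-V}/∫e^{-V}`).
With `G = φ₀·φ_x` this is the `ν`-derivative of the two-point function entering
`χ̂'_N = ∂χ_N/∂ν` of §8.2. [folklore] -/
theorem hasDerivAt_expect [NeZero M] (α : ℝ) {g : ℝ} (hg : 0 < g) (ν₀ : ℝ)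
    {G : (TorusSite d M → Fin n → ℝ) → ℝ} (hGc : Continuous G) {B : ℝ} {k : ℕ}
    (hGb : ∀ φ, |G φ| ≤ B * ∏ x, (1 + sqNorm (φ x)) ^ k) :
    HasDerivAt (fun ν => expect d M n α g ν G)
      (-(1 / 2) * (expect d M n α g ν₀ (fun φ => G φ * ∑ x, sqNorm (φ x)) -
        expect d M n α g ν₀ G * expect d M n α g ν₀ (fun φ => ∑ x, sqNorm (φ x)))) ν₀ := by
  have hN := hasDerivAt_integral_mul_exp_neg_potential (d := d) (M := M) (n := n) α hg ν₀ hGc hGb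
  have hZ := hasDerivAt_partitionFunction (d := d) (M := M) (n := n) α hg ν₀
  have hZpos := integral_exp_neg_potential_pos (d := d) (M := M) (n := n) α hg ν₀
  have hdiv := hN.div hZ hZpos.ne'
  have hfun : (fun ν => expect d M n α g ν G) = fun ν =>
      (∫ φ, G φ * Real.exp (-potential d M n α g ν φ)) /
        ∫ φ, Real.exp (-potential d M n α g ν φ) := by
    funext ν
    exact expect_eq_integral_div α g ν G
  rw [hfun]
  refine hdiv.congr_deriv ?_
  -- rewrite the three expectations and the two derivative integrals
  rw [expect_eq_integral_div, expect_eq_integral_div, expect_eq_integral_div]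
  set Z : ℝ := ∫ φ, Real.exp (-potential d M n α g ν₀ φ) with hZ_def
  set N : ℝ := ∫ φ, G φ * Real.exp (-potential d M n α g ν₀ φ) with hN_def
  set IGS : ℝ := ∫ φ, G φ * (∑ x, sqNorm (φ x)) * Real.exp (-potential d M n α g ν₀ φ)
    with hIGS_def
  set IS : ℝ := ∫ φ : TorusSite d M → Fin n → ℝ,
    (∑ x, sqNorm (φ x)) * Real.exp (-potential d M n α g ν₀ φ) with hIS_def
  have hN' : ∫ φ, G φ * (-(∑ x, sqNorm (φ x)) / 2) * Real.exp (-potential d M n α g ν₀ φ)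
      = -(1 / 2) * IGS := by
    rw [hIGS_def, ← integral_const_mul]
    refine integral_congr_ae (ae_of_all _ fun φ => ?_)
    simp only
    ring
  have hZ' : ∫ φ : TorusSite d M → Fin n → ℝ,
      (-(∑ x, sqNorm (φ x)) / 2) * Real.exp (-potential d M n α g ν₀ φ) = -(1 / 2) * IS := by
    rw [hIS_def, ← integral_const_mul]
    refine integral_congr_ae (ae_of_all _ fun φ => ?_)
    simp only
    ring
  rw [hN', hZ']
  field_simp
  ring

/-- **The finite-volume susceptibility is differentiable in `ν`** (`g > 0`):
`ν ↦ χ_N(g,ν) = n⁻¹Σ_{x∈Λ}⟨φ₀·φ_x⟩_{g,ν,N}` (`torusSusceptibility`) is differentiable at every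
`ν₀` — the existence of "`χ̂_N'` … the derivative of `χ̂_N` with respect to `ν₀` … equal to the
partial derivative of `χ_N` with respect to `ν`" presupposed in §8.2.
[cite: Slade2017, §8.2 (χ̂'_N, after Lemma 8.2.1)] -/
theorem differentiableAt_torusSusceptibility [NeZero M] (α : ℝ) {g : ℝ} (hg : 0 < g) (ν₀ : ℝ) :
    DifferentiableAt ℝ (fun ν => torusSusceptibility d M n α g ν) ν₀ := by
  unfold torusSusceptibility
  refine DifferentiableAt.const_mul ?_ _
  refine DifferentiableAt.fun_sum fun x _ => ?_
  have hGc : Continuous fun φ : TorusSite d M → Fin n → ℝ => ∑ i, φ 0 i * φ x i := by fun_prop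
  have hGb : ∀ φ : TorusSite d M → Fin n → ℝ,
      |∑ i, φ 0 i * φ x i| ≤ 1 * ∏ x, (1 + sqNorm (φ x)) ^ 1 := fun φ => by
    rw [one_mul]
    simp_rw [pow_one]
    exact (abs_dot_le_sum_sqNorm φ 0 x).trans
      (sum_le_prod_one_add _ _ fun x _ => sqNorm_nonneg _)
  exact (hasDerivAt_expect (d := d) (M := M) (n := n) α hg ν₀ hGc hGb).differentiableAt

/-- For `L ≥ 1` and `g > 0`, `ν ↦ χ_N(g,ν)` on `Λ_N = (ℤ/L^Nℤ)^d` (`torusSusceptibilityPow d L N n α g ν`,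
the sequence whose limit is `HasSusceptibility`) is differentiable on `ℝ`.
[cite: Slade2017, §8.2 (χ̂'_N, after Lemma 8.2.1)] -/
theorem differentiable_torusSusceptibilityPow {L : ℕ} (hL : L ≠ 0) (N : ℕ) (α : ℝ) {g : ℝ}
    (hg : 0 < g) :
    Differentiable ℝ fun ν => torusSusceptibilityPow d L N n α g ν := by
  haveI : NeZero (L ^ N) := ⟨pow_ne_zero N hL⟩
  have hfun : (fun ν => torusSusceptibilityPow d L N n α g ν) =
      fun ν => torusSusceptibility d (L ^ N) n α g ν := by
    funext ν
    simp only [torusSusceptibilityPow, dif_neg hL]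
  rw [hfun]
  exact fun ν => differentiableAt_torusSusceptibility α hg ν

end LongRangePhi4

end Literature.Barriers.CriticalPhenomena

end
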